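import Summits.AnomalousDissipation.AnomalousDissipation.Theorems.SawtoothPulseCascadeK1LocalisedCascadeTraceKernelsDeriv

/-!
# K1loc — helper: MOMENT KERNELS OF THE BOX-PRODUCT TRAPEZOID, H INDEXING («CT-GEO» 4b/4)

Helper file of the prover lane on the crux `K1LocalisedCascade` (stmt-AnomalousDissipation-19491), route
`SawtoothPulseCascade` (S-D fibre ledger, corner-trace track; finding F-p1g9-1, memo v15).  The H-indexed twins
(`T_i(n) = Σ_l χ_l l^i 𝓕v(n,l) e^{2πily}`) of `…TraceKernelsDeriv.norm_momentTrace_neg_v` /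
`sum_sq_trace_boxTrapezoid_moment_sign_le_v`: the sign-split sup-line inputs of the derivative traces for the H half-step,
`Σ_{n>0 / n<0} |T_i(n)|² ≤ ((L+R−1)^i·√((2L+R)R)/R·B)²/2`.  Same proofs with the Fourier index swapped.
No definitions; nothing about the crux. [cite: Grafakos2014, Prop. 3.1.2 (5), Prop. 3.2.7 (3), §3.1.3] [problem: turb]
-/

-- `Summit.<Summit>.<Problem>`: single-conjunct summit, the duplicate namespace segment is deliberate.
set_option linter.dupNamespace false

noncomputable section

namespace Summit.AnomalousDissipation.AnomalousDissipation.Theorems.SawtoothPulseCascade.K1Window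

open MeasureTheory Complex UnitAddTorus
open scoped Real ComplexConjugate
open Literature.Analysis.FunctionSpaces Literature.Analysis.FunctionSpaces.Torus

/-- For a real input `v` and the (even, real) box trapezoid, the moment traces have the norm symmetry `‖T_i(−n)‖ = ‖T_i(n)‖`
(H indexing: `T_i(n) = Σ_l χ_l l^i 𝓕v(n,l) e^{2πily}`). [folklore] -/
theorem norm_momentTrace_neg_h (v : UnitAddTorus (Fin 2) → ℝ) (L R : ℕ) (i : ℕ) (n : ℤ) (y : ℝ) :
    ‖∑ l ∈ Finset.Icc (-((L + R : ℕ) : ℤ)) (L + R : ℕ),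
      (((((Finset.Ico (-(L : ℤ)) (-(L : ℤ) + (2 * L + R : ℕ))) ×ˢ (Finset.Ico (0 : ℤ) R)).filter
        (fun p : ℤ × ℤ => p.1 - p.2 = l)).card : ℂ) / R) * (l : ℂ) ^ i * mFourierCoeff (fun x => (v x : ℂ)) ![-n, l] *
          cexp (2 * π * I * l * y)‖ =
    ‖∑ l ∈ Finset.Icc (-((L + R : ℕ) : ℤ)) (L + R : ℕ),
      (((((Finset.Ico (-(L : ℤ)) (-(L : ℤ) + (2 * L + R : ℕ))) ×ˢ (Finset.Ico (0 : ℤ) R)).filter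
        (fun p : ℤ × ℤ => p.1 - p.2 = l)).card : ℂ) / R) * (l : ℂ) ^ i * mFourierCoeff (fun x => (v x : ℂ)) ![n, l] *
          cexp (2 * π * I * l * y)‖ := by
  classical
  set χ : ℤ → ℂ := fun l => (((((Finset.Ico (-(L : ℤ)) (-(L : ℤ) + (2 * L + R : ℕ))) ×ˢ (Finset.Ico (0 : ℤ) R)).filter
        (fun p : ℤ × ℤ => p.1 - p.2 = l)).card : ℂ) / R) with hχ
  have hχe : ∀ l, χ (-l) = χ l := fun l => by
    simp only [hχ]; rw [boxTrapezoid_even]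
  have hχr : ∀ l, conj (χ l) = χ l := fun l => by
    simp only [hχ, map_div₀, map_natCast]
  -- `T_i(−n) = (−1)^i · conj(T_i(n))` after the substitution `l ↦ −l`
  set S : Finset ℤ := Finset.Icc (-((L + R : ℕ) : ℤ)) (L + R : ℕ) with hS
  have himg : S.image (fun l => -l) = S := by
    ext l; simp only [hS, Finset.mem_image, Finset.mem_Icc]
    constructor
    · rintro ⟨m, ⟨h1, h2⟩, rfl⟩; omega
    · rintro ⟨h1, h2⟩; exact ⟨-l, ⟨by omega, by omega⟩, by ring⟩
  have key : ∀ m : ℤ, χ (-m) * ((-m : ℤ) : ℂ) ^ i * mFourierCoeff (fun x => (v x : ℂ)) ![-n, -m] *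
      cexp (2 * π * I * ((-m : ℤ) : ℂ) * y) =
      (-1) ^ i * conj (χ m * (m : ℂ) ^ i * mFourierCoeff (fun x => (v x : ℂ)) ![n, m] * cexp (2 * π * I * m * y)) := by
    intro m
    have hb : mFourierCoeff (fun x => (v x : ℂ)) ![-n, -m] = conj (mFourierCoeff (fun x => (v x : ℂ)) ![n, m]) := by
      rw [← mFourierCoeff_ofReal_neg]
      congr 1
      ext j; fin_cases j <;> simp
    have he : cexp (2 * π * I * ((-m : ℤ) : ℂ) * y) = conj (cexp (2 * π * I * m * y)) := by
      rw [← Complex.exp_conj]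
      congr 1
      simp only [map_mul, map_ofNat, Complex.conj_ofReal, Complex.conj_I, map_intCast]
      push_cast; ring
    rw [hχe, hb, he, map_mul, map_mul, map_mul, hχr, map_pow, map_intCast]
    push_cast
    rw [neg_pow]
    ring
  have hsum : ∑ l ∈ S, χ l * (l : ℂ) ^ i * mFourierCoeff (fun x => (v x : ℂ)) ![-n, l] * cexp (2 * π * I * l * y) =
      (-1) ^ i * conj (∑ l ∈ S, χ l * (l : ℂ) ^ i * mFourierCoeff (fun x => (v x : ℂ)) ![n, l] * cexp (2 * π * I * l * y)) := by
    rw [map_sum, Finset.mul_sum]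
    conv_lhs => rw [← himg]
    rw [Finset.sum_image (fun a _ b _ h => neg_injective h)]
    exact Finset.sum_congr rfl fun m _ => key m
  simp only [hχ, hS] at hsum ⊢
  rw [hsum, norm_mul, norm_pow, norm_neg, norm_one, one_pow, one_mul, RCLike.norm_conj]

/-- **Sign-split moment trace bounds for the box trapezoid, H indexing**: for a real continuous input `|v| ≤ B`, a sign-symmetric
fibre set `F`, every `i`, `y`: both halves `≤ ((L+R−1)^i·√((2L+R)R)/R·B)²/2`. [cite: Grafakos2014, Prop. 3.1.2 (5), Prop. 3.2.7 (3)] -/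
theorem sum_sq_trace_boxTrapezoid_moment_sign_le_h {v : UnitAddTorus (Fin 2) → ℝ} (hv : Continuous v) {B : ℝ}
    (hB : ∀ x, |v x| ≤ B) (L : ℕ) {R : ℕ} (hR : 0 < R) (F : Finset ℤ) (hF : ∀ n ∈ F, -n ∈ F) (i : ℕ) (y : ℝ) :
    ∑ n ∈ F.filter (fun n => 0 < n), ‖∑ l ∈ Finset.Icc (-((L + R : ℕ) : ℤ)) (L + R : ℕ),
      (((((Finset.Ico (-(L : ℤ)) (-(L : ℤ) + (2 * L + R : ℕ))) ×ˢ (Finset.Ico (0 : ℤ) R)).filter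
        (fun p : ℤ × ℤ => p.1 - p.2 = l)).card : ℂ) / R) * (l : ℂ) ^ i * mFourierCoeff (fun x => (v x : ℂ)) ![n, l] *
          cexp (2 * π * I * l * y)‖ ^ 2 ≤ (((L : ℝ) + R - 1) ^ i * (Real.sqrt ((2 * L + R : ℕ) * R) / R) * B) ^ 2 / 2 ∧
    ∑ n ∈ F.filter (fun n => n < 0), ‖∑ l ∈ Finset.Icc (-((L + R : ℕ) : ℤ)) (L + R : ℕ),
      (((((Finset.Ico (-(L : ℤ)) (-(L : ℤ) + (2 * L + R : ℕ))) ×ˢ (Finset.Ico (0 : ℤ) R)).filter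
        (fun p : ℤ × ℤ => p.1 - p.2 = l)).card : ℂ) / R) * (l : ℂ) ^ i * mFourierCoeff (fun x => (v x : ℂ)) ![n, l] *
          cexp (2 * π * I * l * y)‖ ^ 2 ≤ (((L : ℝ) + R - 1) ^ i * (Real.sqrt ((2 * L + R : ℕ) * R) / R) * B) ^ 2 / 2 := by
  classical
  have hvc : Continuous fun x => (v x : ℂ) := Complex.continuous_ofReal.comp hv
  have hvi : Integrable (fun x => (v x : ℂ)) volume := hvc.integrable_of_hasCompactSupport (HasCompactSupport.of_compactSpace _)
  have hB' : ∀ x, ‖(v x : ℂ)‖ ≤ B := fun x => by rw [Complex.norm_real, Real.norm_eq_abs]; exact hB x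
  -- the full trace bound through `…TraceInput` with the multiplier `χ_l l^i`, over the open interval
  have hfull := sum_sq_trace_le_hfibre hvi hB' (fun l => (((((Finset.Ico (-(L : ℤ)) (-(L : ℤ) + (2 * L + R : ℕ))) ×ˢ
      (Finset.Ico (0 : ℤ) R)).filter (fun p : ℤ × ℤ => p.1 - p.2 = l)).card : ℂ) / R) * (l : ℂ) ^ i)
    (Finset.Ioo (-(L : ℤ) - R) (-(L : ℤ) + (2 * L + R : ℕ))) F y (integral_norm_symmTrapezoid_momentKernel_le L hR i y)
  -- rewrite the source sums over `[−(L+R), L+R]`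
  have hIcc : ∀ n : ℤ, ∑ l ∈ Finset.Icc (-((L + R : ℕ) : ℤ)) (L + R : ℕ),
      (((((Finset.Ico (-(L : ℤ)) (-(L : ℤ) + (2 * L + R : ℕ))) ×ˢ (Finset.Ico (0 : ℤ) R)).filter
        (fun p : ℤ × ℤ => p.1 - p.2 = l)).card : ℂ) / R) * (l : ℂ) ^ i * mFourierCoeff (fun x => (v x : ℂ)) ![n, l] *
          cexp (2 * π * I * l * y) =
      ∑ l ∈ Finset.Ioo (-(L : ℤ) - R) (-(L : ℤ) + (2 * L + R : ℕ)),
        (((((Finset.Ico (-(L : ℤ)) (-(L : ℤ) + (2 * L + R : ℕ))) ×ˢ (Finset.Ico (0 : ℤ) R)).filter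
          (fun p : ℤ × ℤ => p.1 - p.2 = l)).card : ℂ) / R) * (l : ℂ) ^ i * mFourierCoeff (fun x => (v x : ℂ)) ![n, l] *
            cexp (2 * π * I * l * y) := by
    intro n
    have h := sum_Icc_boxTrapezoid_eq_sum_Ioo L R (fun l => (l : ℂ) ^ i * mFourierCoeff (fun x => (v x : ℂ)) ![n, l])
      (fun l => cexp (2 * π * I * l * y))
    simp only [← mul_assoc] at h
    exact h
  refine sum_filter_sign_le_half_of_norm _ (fun n => norm_momentTrace_neg_h v L R i n y) F hF ?_
  simp_rw [hIcc]
  simpa only [mul_assoc] using hfull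

end Summit.AnomalousDissipation.AnomalousDissipation.Theorems.SawtoothPulseCascade.K1Window
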